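import Summits.HodgeConjecture.HodgeConjecture.Theorems.R90S9DefiniteXiMembershipCut      -- ★ p861479 (p04): the (AE) clause and (S-G) tail currency of `hRig` (D6)
import Summits.HodgeConjecture.HodgeConjecture.Theorems.R90S5EvpOfAeRouting             -- ★ p861517 (S5): brings ★ `RoutesAt`, `clFinChoice`, the rung-0 Haar ∕ Keys suppliers (`F0P3Rung0HaarPackage`, `exists_keysData_of_keysCaseTwo`, `keysCaseTwo_of_stubs`)
import Summits.HodgeConjecture.HodgeConjecture.Theorems.R90S5HasFinComponentOfDiscrete    -- ★ (K2E1-p12): `R90.S5.admUnitConstituents_nonempty_of_anisotropic` (AFA at anisotropic `H`, ★ p861871)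
import Summits.HodgeConjecture.HodgeConjecture.Theorems.R90S5FamilyPinOfSplitCofinite       -- ★ (S5 road S): `R90.S5.xi_eq_of_routesAt_of_memXiFamily_of_not_mem` — routed by `ξ` + in the `ξ′`-envelope ⇒ `ξ = ξ′`
import HarnessLib

/-!
# R90-TF · S9 «InnerForm-13.3.6 (c)» — THE READ-BACK PIN OF THE (AE-ⅱ) CUT, Γ-FREE: (AE) + «`P` lies in a ξ′-local family whose second members are the SIGNED witnesses» ⟹ (S-G)
# (Rogawski 1990 Thm. 14.6.4 p. 244 «there exists a UNIQUE ξ … `Π′ = Π′(ξ)`»; `Π′(ξ_v) = Π(ξ_v) = {πⁿ(ξ_v), πˢ(ξ_v)}` p. 244; Prop. 13.1.3 (d), Prop. 13.1.4 p. 199; §12.2 (2) p. 174)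

Cell `hodgecm-mathlib`, crux H413 (`stmt-HodgeConjecture-24833`, lane `--supports … --as helper`), route of record `HCCMUnconditional` (no route verbs; count-neutral).
Programme R90-TF (brief `director/R90-BRIEF.v2.md` 1f40d54518340a35), section S9 = InnerForm-13.3.6 (c) (base `R90-IF`); seat R90-IF-p06 (g0); R90-IF-plan (g0) RULING 16:30:40Z (1):
«p06's sequel after (E)∕(H) ★ is the `hback` READ-BACK pin (unique ξ′ [14.6.4] + Π′(ξ_v) = {πⁿ, πˢ}(ξ_v) ∘ e [p. 244, 13.1.3 (d)] + πˢ ∘ e = hQS-witness [S3 ★])».  THIS FILE proves that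
pin's CONTENT in the tree's concrete D6 currency, Γ-free: the engine ★ `definiteAeRigidityAt_of_parts` (p861961) takes
`hback : ∀ ξ′ h₁ hS, Γ.evp (Γ.PiXi′ ξ′ h₁ hS) Pξ → Γ.mem′ π′ (Γ.PiXi′ ξ′ h₁ hS) → ‹(S-G) tail›`; at the CONCRETE datum (R90-IF-p01 `InnerFormSec146Data`, `memPrimeFin (classOf P) F ↔
LocalConstituentsIn P F`, `Π′(ξ′)`'s finite part = a ξ′-local family ★ `IsXiLocalFamily` with the record's SIGNED second members) `Γ.mem′ π′ (Γ.PiXi′ ξ′ …)` READS «`LocalConstituentsIn P F`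
for a ξ′-local family `F` whose second members are the `hQS ξ′`-witnesses» — and from THAT plus (AE) this file derives the (S-G) tail (`sgTail_of_ae_of_xiLocalFamily`), so the
datum-level `hback₀` is `fun ξ′ h₁ hS _ hmem′ => sgTail_of_ae_of_xiLocalFamily … hAE ξ′ F hF hmem′ hFs` with `hF`, `hFs` the datum's own ★ read-backs.  THEOREMS ONLY (no `def`,
no instance, no notation, no named fact, no `sorry`).
HONEST LABEL: HC_CM is proved only modulo the 7 printed citations (2 remaining named inputs: hLiu418 = stmt-HodgeConjecture-24832, h413 = stmt-HodgeConjecture-24833) — until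
rung 0 closes.  D6 book-keeping + ★ S5 rigidity of `ξ` from the split places; no leaf moves; REL ≠ ★ ≠ BUILT.

THE MATHEMATICS.  (AE) routes `P` by `ξ` off a finite `S` (§1 `routesAt_of_ae`: at an anisotropic `H` the chosen class ★ `clFinChoice P v` IS a constituent — «AFA» ★
`R90.S5.admUnitConstituents_nonempty_of_anisotropic` — so the (AE) clauses pin it: split `v` by the singleton ★ `cmSplitPacket_members`, non-split `v` at the V6 Keys data).  If
moreover `P`'s finite constituents lie in a ξ′-LOCAL FAMILY `F` (★ `IsXiLocalFamily`: split packets of `ξ′` at the fixed witnesses; at non-split `v`, `⟨x ∘ e′, s⟩` with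
`x ∈ JH(i_G(χ_{ξ′})) = {πⁿ, π²}` and `s` supercuspidal), then `ξ = ξ′` — Rogawski's «UNIQUE `ξ`» of Thm. 14.6.4, here by ★ `R90.S5.xi_eq_of_routesAt_of_memXiFamily_of_not_mem`
(the split places off a finite set determine `ξ`: ★ `OneDimAutRepH.ext_of_exists_bc_localComponent_eq_of_split_of_not_mem`, Chebotarev-free).  Then at EVERY non-split `v`, frame
`(T, a)` and Keys labels `(π², πⁿ)`: a `v`-constituent `c` of `P` is a member of `F v = ⟨x ∘ e′, s⟩`; either `c = x ∘ e′` with `x ∈ {πⁿ, π²}` (★ `KeysCaseTwoLabels`), and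
`x ∘ e′ = x ∘ e` (★ `comap_cmDatumLocalCongr_symm_eq`, K5 congruence independence for `N = 3`), or `s = some c`, and then `c` is the SIGNED witness `((hQS ξ).1 v …).πs` by
the family's pin `hFs` (at the datum: the record's `πˢ` IS the `hQS`-witness, frame-independent by S3's ★ signed uniqueness ∕ R90-IF-p03's ★ value law
`R90.S9.comap_signedPis_eq_signedPis_transport`).  That is the (S-G) tail of `hRig`, BYTE FOR BYTE.

[cite: Rogawski1990, §14.6 Thm. 14.6.4 p. 244; §13.1 Prop. 13.1.3 (d), Prop. 13.1.4 p. 199; §12.2 (2) pp. 173–174; §13.3 Thm. 13.3.5 p. 202, p. 201; §4.13 Lemma 4.13.1 (b); §14.2 p. 234]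
[cite: FlathCorvallis1979, Thm. 3] [cite: CasselsFrohlichANT1967, Ch. VII §4 Prop. 4.1]
-/

set_option autoImplicit false
-- the mandated namespace repeats `HodgeConjecture.HodgeConjecture`, as in every `Theorems/*.lean` of this sub-problem
set_option linter.dupNamespace false

noncomputable section

open NumberField IsDedekindDomain MeasureTheory
open scoped Matrix ComplexOrder

open Literature.NumberTheory Literature.NumberTheory.Automorphic Literature.NumberTheory.Automorphic.UnitaryGroup
open Literature.NumberTheory.Automorphic.IdeleClassGroup
open Literature.NumberTheory.GaloisRepresentations
open Literature.NumberTheory.Rogawski1990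

namespace Summit.HodgeConjecture.HodgeConjecture.R90.S9

open Summit.HodgeConjecture.HodgeConjecture.Cruxes.H413
open Summit.HodgeConjecture.HodgeConjecture.Cruxes.H413.F0P3ClassTokenChoice (clFinChoice admUnitConstituents clFinChoice_isConstituentOf_of_nonempty)
open Summit.HodgeConjecture.HodgeConjecture.Cruxes.H413.F0P3CohClassRoutingCot (RoutesAt)
open Summit.HodgeConjecture.HodgeConjecture.Cruxes.H413.F0P3cDbTEnvelopeTrichotomy (comap_cmDatumLocalCongr_symm_eq)

/-! ## §1 (AE) routes `P` by `ξ` off a finite set, for ANY V6 data (anisotropic `H`) -/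

open scoped Classical in
set_option synthInstance.maxHeartbeats 400000 in
set_option maxHeartbeats 8000000 in
/-- **`routesAt_of_ae` — (AE) ROUTES `P` BY `ξ` OFF A FINITE SET** (anisotropic `H`, any V6 data: Borel Haar measures `μZ v` on the `U(Φ₃)(L⁺_v)⧸Z` and Keys' labelled pairs
`keys` with their `L²` data).  «AFA» at the anisotropic `H` (★ `R90.S5.admUnitConstituents_nonempty_of_anisotropic`) makes ★ `clFinChoice P v` a `v`-constituent of `P`
(★ `clFinChoice_isConstituentOf_of_nonempty`); the split clause of (AE) puts it in the SINGLETON split packet (★ `cmSplitPacket_members`), the non-split clause (read at the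
frame, at `μZ v`, at the labels `keys ξ v hns` with `¬ πⁿ L²`) makes it `πⁿ ∘ e` — i.e. ★ `RoutesAt … P ξ v` for every `v ∉ S`.
[cite: Rogawski1990, §13.3 p. 201; §13.1 p. 199; §12.2 (2) pp. 173–174; §14.5 p. 237] [cite: FlathCorvallis1979, Thm. 3] -/
theorem routesAt_of_ae
    (L : Type) [Field L] [NumberField L] [IsCMField L] (H : Matrix (Fin 3) (Fin 3) L)
    (hH : (H.map (cmConjRingHom L))ᵀ = H) (hHd : IsUnit H.det)
    (hanis : ∀ x : Fin 3 → L, Literature.AlgebraicGeometry.ShimuraVarieties.hermForm (cmConjRingHom L) H x x = 0 → x = 0)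
    (μω : HeckeCharacter L) (hμu : μω.IsUnitary)
    [∀ v : HeightOneSpectrum (𝓞 ↥(maximalRealSubfield L)), MeasurableSpace (Gqs L v ⧸ Subgroup.center (Gqs L v))]
    [∀ v : HeightOneSpectrum (𝓞 ↥(maximalRealSubfield L)), BorelSpace (Gqs L v ⧸ Subgroup.center (Gqs L v))]
    (μZ : ∀ v : HeightOneSpectrum (𝓞 ↥(maximalRealSubfield L)), Measure (Gqs L v ⧸ Subgroup.center (Gqs L v)))
    [∀ v : HeightOneSpectrum (𝓞 ↥(maximalRealSubfield L)), (μZ v).IsHaarMeasure]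
    (keys : ∀ (ξ : OneDimAutRepH L) (v : HeightOneSpectrum (𝓞 ↥(maximalRealSubfield L))),
      (∀ w : PlacesOver L v, IsCMField.complexConj L • w.1 = w.1) →
        {p : IrrClass (Gqs L v) × IrrClass (Gqs L v) //
          KeysCaseTwoLabels L v (μω.semilocalComponent L v) (torusLocalComponent L (IsCMField.complexConj L) v ξ.η)
            (torusLocalComponent L (IsCMField.complexConj L) v ξ.ψ) p.1 p.2 ∧
          p.1.IsSquareIntegrable (μZ v) ∧ ¬ p.2.IsSquareIntegrable (μZ v)})
    (ξ : OneDimAutRepH L)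
    (μA : Measure (adelicGroupData (↥(maximalRealSubfield L)) L (IsCMField.complexConj L) 3 H).automorphicQuotient)
    [(adelicGroupData (↥(maximalRealSubfield L)) L (IsCMField.complexConj L) 3 H).IsAutomorphicMeasure μA]
    (P : DiscreteAutomorphicRep (adelicGroupData (↥(maximalRealSubfield L)) L (IsCMField.complexConj L) 3 H) μA)
    (hAE :
      (∃ S : Finset (HeightOneSpectrum (𝓞 ↥(maximalRealSubfield L))),
        (∀ v : HeightOneSpectrum (𝓞 ↥(maximalRealSubfield L)), v ∉ S →
          ∀ (hns : ∀ w : PlacesOver L v, IsCMField.complexConj L • w.1 = w.1)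
            (T : GL (Fin 3) (LocalRing L v)) (a : LocalRing L v) (ha : IsUnit a)
            (h : formCongr (conjLocal L (IsCMField.complexConj L) v) T (H.map (algebraMap L (LocalRing L v))) =
              a • (Matrix.of fun i j : Fin 3 => if i.val + j.val + 1 = 3 then (1 : L) else 0).map (algebraMap L (LocalRing L v))),
          ∀ [MeasurableSpace (Gqs L v ⧸ Subgroup.center (Gqs L v))] [BorelSpace (Gqs L v ⧸ Subgroup.center (Gqs L v))]
            (μZ : Measure (Gqs L v ⧸ Subgroup.center (Gqs L v))) [μZ.IsHaarMeasure],
          ∀ (π2 πn : IrrClass (Gqs L v)),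
            KeysCaseTwoLabels L v (μω.semilocalComponent L v) (torusLocalComponent L (IsCMField.complexConj L) v ξ.η)
              (torusLocalComponent L (IsCMField.complexConj L) v ξ.ψ) π2 πn →
            ¬ πn.IsSquareIntegrable μZ →
            ∀ c : IrrClass ((cmDatum L 3 H).Local v),
              (IrrClass.comap (localPiEquiv L (IsCMField.complexConj L) 3 H v) c).IsConstituentOf
                  (P.finRep.smoothPart.toRepresentation.comp (inclPlace (↥(maximalRealSubfield L)) L (IsCMField.complexConj L) 3 H v)) →
              c = IrrClass.comap (cmDatumLocalCongr L v T ha h).symm πn) ∧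
        (∀ v : HeightOneSpectrum (𝓞 ↥(maximalRealSubfield L)), v ∉ S →
          ∀ (hs : ∃ w : PlacesOver L v, IsCMField.complexConj L • w.1 ≠ w.1),
            ∀ c : IrrClass ((cmDatum L 3 H).Local v),
              (IrrClass.comap (localPiEquiv L (IsCMField.complexConj L) 3 H v) c).IsConstituentOf
                  (P.finRep.smoothPart.toRepresentation.comp (inclPlace (↥(maximalRealSubfield L)) L (IsCMField.complexConj L) 3 H v)) →
              c ∈ (cmSplitPacket L H hH hHd v (splitWitness v hs) (splitWitness_spec v hs) (ξ.splitν₀ μω (splitWitness v hs).1)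
                (ξ.locψ (splitWitness v hs).1) (ξ.norm_splitν₀_apply hμu (splitWitness v hs).1)
                (ξ.continuous_splitν₀ μω (splitWitness v hs).1) (ξ.norm_locψ_apply (splitWitness v hs).1)
                (ξ.continuous_locψ (splitWitness v hs).1)).members))) :
    ∃ S : Finset (HeightOneSpectrum (𝓞 ↥(maximalRealSubfield L))),
      ∀ v : HeightOneSpectrum (𝓞 ↥(maximalRealSubfield L)), v ∉ S → RoutesAt L H hH hHd μω hμu μZ keys μA P ξ v := by
  -- at an anisotropic `H` every discrete `P` has an admissible unitarizable constituent at every `v` («AFA» ★), so `clFinChoice P v` is a constituent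
  have hcons : ∀ v : HeightOneSpectrum (𝓞 ↥(maximalRealSubfield L)),
      (IrrClass.comap (localPiEquiv L (IsCMField.complexConj L) 3 H v) (clFinChoice P v)).IsConstituentOf
        (P.finRep.smoothPart.toRepresentation.comp (inclPlace (↥(maximalRealSubfield L)) L (IsCMField.complexConj L) 3 H v)) :=
    fun v => clFinChoice_isConstituentOf_of_nonempty P v (R90.S5.admUnitConstituents_nonempty_of_anisotropic L H μA hanis P v)
  obtain ⟨S, hAEns, hAEs⟩ := hAE
  refine ⟨S, fun v hv => ⟨fun hs => ?_, fun hns T a ha h _ => ?_⟩⟩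
  · have hc := hAEs v hv hs (clFinChoice P v) (hcons v)
    rwa [cmSplitPacket_members, Set.mem_singleton_iff] at hc
  · exact hAEns v hv hns T a ha h (μZ v) (keys ξ v hns).1.1 (keys ξ v hns).1.2 (keys ξ v hns).2.1 (keys ξ v hns).2.2.2
      (clFinChoice P v) (hcons v)

/-! ## §2 The read-back: (AE) + a ξ′-local family with SIGNED second members ⟹ the (S-G) tail of `hRig` -/

open scoped Classical in
set_option synthInstance.maxHeartbeats 400000 in
set_option maxHeartbeats 8000000 in
/-- **`sgTail_of_ae_of_xiLocalFamily` — THE `hback` CONTENT, Γ-FREE.**  Binders: the `hRig` prefix of ★ `definiteXiMembership_of_ch14` that the texts mention, with the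
guards `hanis` (anisotropic `H`) and `hμω` (`μ|𝕀_{L⁺} = ω_{L/L⁺}`) — all (B4)∕`hRig` binders; (AE) for `ξ` (BYTES of `hRig`'s clause); a one-dimensional `ξ′`, a family
`F v ∈ CMLocalAPacket L H v` which IS a ξ′-local family (★ `IsXiLocalFamily`) CONTAINING the finite constituents of `P` (★ `LocalConstituentsIn` — the datum's
`Γ.mem′ (classOf P) (Γ.PiXi′ ξ′ …)` read back), whose SECOND MEMBERS ARE THE SIGNED WITNESSES: `(F v).πs = some c → c = ((hQS ξ′).1 v hns T a ha h μZ π2 πn hK hn).πs` for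
every frame and Keys labels (`hFs`; at the datum = the record's `πˢ` pin, S3).  Conclusion = the (S-G) tail of `hRig` for `ξ`, BYTE FOR BYTE.  Proof: §1 + ★
`R90.S5.xi_eq_of_routesAt_of_memXiFamily_of_not_mem` give `ξ = ξ′` (Thm. 14.6.4's «unique `ξ`», from the split places off `S`, at the CHOSEN rung-0 Haar family ★
`exists_isHaarMeasure_gqs_quotient_center` and Keys data ★ `exists_keysData_of_keysCaseTwo` — hypothesis-free); then membership in `F v = ⟨x ∘ e′, s⟩` (★ `IsXiLocalFamily`
(N)) splits as `c = x ∘ e′`, `x ∈ {πⁿ, π²}` by ★ `KeysCaseTwoLabels`, `= x ∘ e` by ★ `comap_cmDatumLocalCongr_symm_eq`; or `s = some c` and `hFs`.  No sorry; axioms TRIO.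
[cite: Rogawski1990, §14.6 Thm. 14.6.4 p. 244; §13.1 Prop. 13.1.3 (d), Prop. 13.1.4 p. 199; §12.2 (2) p. 174; §13.3 p. 201; §14.2 p. 234] [cite: FlathCorvallis1979, Thm. 3] -/
theorem sgTail_of_ae_of_xiLocalFamily
    (L : Type) [Field L] [NumberField L] [IsCMField L] (H : Matrix (Fin 3) (Fin 3) L)
    (hH : (H.map (cmConjRingHom L))ᵀ = H) (hHd : IsUnit H.det)
    (hanis : ∀ x : Fin 3 → L, Literature.AlgebraicGeometry.ShimuraVarieties.hermForm (cmConjRingHom L) H x x = 0 → x = 0)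
    [∀ v : HeightOneSpectrum (𝓞 ↥(maximalRealSubfield L)), MeasurableSpace ((cmDatum L 3 H).Local v)]
    [∀ v : HeightOneSpectrum (𝓞 ↥(maximalRealSubfield L)),
      MeasurableSpace ((cmDatum L 2 (Matrix.of fun i j : Fin 2 => if i.val + j.val + 1 = 2 then (1 : L) else 0)).Local v ×
        (cmDatum L 1 (Matrix.of fun i j : Fin 1 => if i.val + j.val + 1 = 1 then (1 : L) else 0)).Local v)]
    [∀ (v : HeightOneSpectrum (𝓞 ↥(maximalRealSubfield L)))
        (a : ((cmDatum L 2 (Matrix.of fun i j : Fin 2 => if i.val + j.val + 1 = 2 then (1 : L) else 0)).Local v ×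
          (cmDatum L 1 (Matrix.of fun i j : Fin 1 => if i.val + j.val + 1 = 1 then (1 : L) else 0)).Local v)),
      MeasurableSpace (((cmDatum L 2 (Matrix.of fun i j : Fin 2 => if i.val + j.val + 1 = 2 then (1 : L) else 0)).Local v ×
          (cmDatum L 1 (Matrix.of fun i j : Fin 1 => if i.val + j.val + 1 = 1 then (1 : L) else 0)).Local v) ⧸
        Subgroup.centralizer ({a} : Set ((cmDatum L 2 (Matrix.of fun i j : Fin 2 => if i.val + j.val + 1 = 2 then (1 : L) else 0)).Local v ×
          (cmDatum L 1 (Matrix.of fun i j : Fin 1 => if i.val + j.val + 1 = 1 then (1 : L) else 0)).Local v)))]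
    [∀ (v : HeightOneSpectrum (𝓞 ↥(maximalRealSubfield L))) (γ : (cmDatum L 3 H).Local v),
      MeasurableSpace ((cmDatum L 3 H).Local v ⧸ Subgroup.centralizer ({γ} : Set ((cmDatum L 3 H).Local v)))]
    (Δ : ∀ v : HeightOneSpectrum (𝓞 ↥(maximalRealSubfield L)), LocalTransferFactor L H v)
    (mH : ∀ v : HeightOneSpectrum (𝓞 ↥(maximalRealSubfield L)),
      OrbitalMeasureFamily ((cmDatum L 2 (Matrix.of fun i j : Fin 2 => if i.val + j.val + 1 = 2 then (1 : L) else 0)).Local v ×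
        (cmDatum L 1 (Matrix.of fun i j : Fin 1 => if i.val + j.val + 1 = 1 then (1 : L) else 0)).Local v))
    (mG : ∀ v : HeightOneSpectrum (𝓞 ↥(maximalRealSubfield L)), OrbitalMeasureFamily ((cmDatum L 3 H).Local v))
    (νG : ∀ v : HeightOneSpectrum (𝓞 ↥(maximalRealSubfield L)), Measure ((cmDatum L 3 H).Local v))
    (νH : ∀ v : HeightOneSpectrum (𝓞 ↥(maximalRealSubfield L)),
      Measure ((cmDatum L 2 (Matrix.of fun i j : Fin 2 => if i.val + j.val + 1 = 2 then (1 : L) else 0)).Local v ×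
        (cmDatum L 1 (Matrix.of fun i j : Fin 1 => if i.val + j.val + 1 = 1 then (1 : L) else 0)).Local v))
    [∀ v : HeightOneSpectrum (𝓞 ↥(maximalRealSubfield L)), BorelSpace ((cmDatum L 3 H).Local v)]
    [∀ v : HeightOneSpectrum (𝓞 ↥(maximalRealSubfield L)),
      BorelSpace ((cmDatum L 2 (Matrix.of fun i j : Fin 2 => if i.val + j.val + 1 = 2 then (1 : L) else 0)).Local v ×
        (cmDatum L 1 (Matrix.of fun i j : Fin 1 => if i.val + j.val + 1 = 1 then (1 : L) else 0)).Local v)]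
    [∀ (v : HeightOneSpectrum (𝓞 ↥(maximalRealSubfield L)))
        (a : ((cmDatum L 2 (Matrix.of fun i j : Fin 2 => if i.val + j.val + 1 = 2 then (1 : L) else 0)).Local v ×
          (cmDatum L 1 (Matrix.of fun i j : Fin 1 => if i.val + j.val + 1 = 1 then (1 : L) else 0)).Local v)),
      BorelSpace (((cmDatum L 2 (Matrix.of fun i j : Fin 2 => if i.val + j.val + 1 = 2 then (1 : L) else 0)).Local v ×
          (cmDatum L 1 (Matrix.of fun i j : Fin 1 => if i.val + j.val + 1 = 1 then (1 : L) else 0)).Local v) ⧸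
        Subgroup.centralizer ({a} : Set ((cmDatum L 2 (Matrix.of fun i j : Fin 2 => if i.val + j.val + 1 = 2 then (1 : L) else 0)).Local v ×
          (cmDatum L 1 (Matrix.of fun i j : Fin 1 => if i.val + j.val + 1 = 1 then (1 : L) else 0)).Local v)))]
    [∀ (v : HeightOneSpectrum (𝓞 ↥(maximalRealSubfield L))) (γ : (cmDatum L 3 H).Local v),
      BorelSpace ((cmDatum L 3 H).Local v ⧸ Subgroup.centralizer ({γ} : Set ((cmDatum L 3 H).Local v)))]
    [∀ v, (νG v).IsHaarMeasure] [∀ v, (νG v).IsMulRightInvariant] [∀ v, (νH v).IsHaarMeasure] [∀ v, (νH v).IsMulRightInvariant]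
    (μω : HeckeCharacter L) (hμu : μω.IsUnitary)
    (hμω : ∀ x : Literature.NumberTheory.GaloisRepresentations.ideleGroup ↥(maximalRealSubfield L),
      μω (AdeleRing.ideleBaseChange (↥(maximalRealSubfield L)) L x) = quadraticHeckeCharCM L x)
    (hQS : CMCharIdentityPackageTestSigned L H hH hHd νH νG μω hμu Δ mH mG)
    (ξ : OneDimAutRepH L)
    (μA : Measure (adelicGroupData (↥(maximalRealSubfield L)) L (IsCMField.complexConj L) 3 H).automorphicQuotient)
    [(adelicGroupData (↥(maximalRealSubfield L)) L (IsCMField.complexConj L) 3 H).IsAutomorphicMeasure μA]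
    (P : DiscreteAutomorphicRep (adelicGroupData (↥(maximalRealSubfield L)) L (IsCMField.complexConj L) 3 H) μA)
    (hAE :
      (∃ S : Finset (HeightOneSpectrum (𝓞 ↥(maximalRealSubfield L))),
        (∀ v : HeightOneSpectrum (𝓞 ↥(maximalRealSubfield L)), v ∉ S →
          ∀ (hns : ∀ w : PlacesOver L v, IsCMField.complexConj L • w.1 = w.1)
            (T : GL (Fin 3) (LocalRing L v)) (a : LocalRing L v) (ha : IsUnit a)
            (h : formCongr (conjLocal L (IsCMField.complexConj L) v) T (H.map (algebraMap L (LocalRing L v))) =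
              a • (Matrix.of fun i j : Fin 3 => if i.val + j.val + 1 = 3 then (1 : L) else 0).map (algebraMap L (LocalRing L v))),
          ∀ [MeasurableSpace (Gqs L v ⧸ Subgroup.center (Gqs L v))] [BorelSpace (Gqs L v ⧸ Subgroup.center (Gqs L v))]
            (μZ : Measure (Gqs L v ⧸ Subgroup.center (Gqs L v))) [μZ.IsHaarMeasure],
          ∀ (π2 πn : IrrClass (Gqs L v)),
            KeysCaseTwoLabels L v (μω.semilocalComponent L v) (torusLocalComponent L (IsCMField.complexConj L) v ξ.η)
              (torusLocalComponent L (IsCMField.complexConj L) v ξ.ψ) π2 πn →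
            ¬ πn.IsSquareIntegrable μZ →
            ∀ c : IrrClass ((cmDatum L 3 H).Local v),
              (IrrClass.comap (localPiEquiv L (IsCMField.complexConj L) 3 H v) c).IsConstituentOf
                  (P.finRep.smoothPart.toRepresentation.comp (inclPlace (↥(maximalRealSubfield L)) L (IsCMField.complexConj L) 3 H v)) →
              c = IrrClass.comap (cmDatumLocalCongr L v T ha h).symm πn) ∧
        (∀ v : HeightOneSpectrum (𝓞 ↥(maximalRealSubfield L)), v ∉ S →
          ∀ (hs : ∃ w : PlacesOver L v, IsCMField.complexConj L • w.1 ≠ w.1),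
            ∀ c : IrrClass ((cmDatum L 3 H).Local v),
              (IrrClass.comap (localPiEquiv L (IsCMField.complexConj L) 3 H v) c).IsConstituentOf
                  (P.finRep.smoothPart.toRepresentation.comp (inclPlace (↥(maximalRealSubfield L)) L (IsCMField.complexConj L) 3 H v)) →
              c ∈ (cmSplitPacket L H hH hHd v (splitWitness v hs) (splitWitness_spec v hs) (ξ.splitν₀ μω (splitWitness v hs).1)
                (ξ.locψ (splitWitness v hs).1) (ξ.norm_splitν₀_apply hμu (splitWitness v hs).1)
                (ξ.continuous_splitν₀ μω (splitWitness v hs).1) (ξ.norm_locψ_apply (splitWitness v hs).1)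
                (ξ.continuous_locψ (splitWitness v hs).1)).members)))
    (ξ' : OneDimAutRepH L) (F : ∀ v : HeightOneSpectrum (𝓞 ↥(maximalRealSubfield L)), CMLocalAPacket L H v)
    (hF : ξ'.IsXiLocalFamily hH hHd μω hμu F) (hFP : LocalConstituentsIn P F)
    (hFs : ∀ (v : HeightOneSpectrum (𝓞 ↥(maximalRealSubfield L))) (hns : ∀ w : PlacesOver L v, IsCMField.complexConj L • w.1 = w.1)
      (T : GL (Fin 3) (LocalRing L v)) (a : LocalRing L v) (ha : IsUnit a)
      (h : formCongr (conjLocal L (IsCMField.complexConj L) v) T (H.map (algebraMap L (LocalRing L v))) =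
        a • (Matrix.of fun i j : Fin 3 => if i.val + j.val + 1 = 3 then (1 : L) else 0).map (algebraMap L (LocalRing L v))),
      ∀ [MeasurableSpace (Gqs L v ⧸ Subgroup.center (Gqs L v))] [BorelSpace (Gqs L v ⧸ Subgroup.center (Gqs L v))]
        (μZ : Measure (Gqs L v ⧸ Subgroup.center (Gqs L v))) [μZ.IsHaarMeasure],
      ∀ (π2 πn : IrrClass (Gqs L v))
        (hK : KeysCaseTwoLabels L v (μω.semilocalComponent L v) (torusLocalComponent L (IsCMField.complexConj L) v ξ'.η)
          (torusLocalComponent L (IsCMField.complexConj L) v ξ'.ψ) π2 πn)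
        (hn : ¬ πn.IsSquareIntegrable μZ) (c : IrrClass ((cmDatum L 3 H).Local v)),
        (F v).πs = some c → c = ((hQS ξ').1 v hns T a ha h μZ π2 πn hK hn).πs) :
    ∀ (v : HeightOneSpectrum (𝓞 ↥(maximalRealSubfield L))) (hns : ∀ w : PlacesOver L v, IsCMField.complexConj L • w.1 = w.1),
    ∀ (T : GL (Fin 3) (LocalRing L v)) (a : LocalRing L v) (ha : IsUnit a)
      (h : formCongr (conjLocal L (IsCMField.complexConj L) v) T (H.map (algebraMap L (LocalRing L v))) =
        a • (Matrix.of fun i j : Fin 3 => if i.val + j.val + 1 = 3 then (1 : L) else 0).map (algebraMap L (LocalRing L v))),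
    ∀ [MeasurableSpace (Gqs L v ⧸ Subgroup.center (Gqs L v))] [BorelSpace (Gqs L v ⧸ Subgroup.center (Gqs L v))]
      (μZ : Measure (Gqs L v ⧸ Subgroup.center (Gqs L v))) [μZ.IsHaarMeasure],
    ∀ (π2 πn : IrrClass (Gqs L v)),
    ∀ (hK : KeysCaseTwoLabels L v (μω.semilocalComponent L v) (torusLocalComponent L (IsCMField.complexConj L) v ξ.η)
        (torusLocalComponent L (IsCMField.complexConj L) v ξ.ψ) π2 πn)
      (hn : ¬ πn.IsSquareIntegrable μZ),
      -- (S-G) «13.3.6 (c) ∕ §14.6 AT PRINT'S PINNED DATA»: every v-constituent of P is πⁿ ∘ e, π² ∘ e, or the πˢ(ξ_v) ∘ e of `hQS`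
      ∀ c : IrrClass ((cmDatum L 3 H).Local v),
        (IrrClass.comap (localPiEquiv L (IsCMField.complexConj L) 3 H v) c).IsConstituentOf
            (P.finRep.smoothPart.toRepresentation.comp (inclPlace (↥(maximalRealSubfield L)) L (IsCMField.complexConj L) 3 H v)) →
        c = IrrClass.comap (cmDatumLocalCongr L v T ha h).symm πn ∨
          c = IrrClass.comap (cmDatumLocalCongr L v T ha h).symm π2 ∨
          c = ((hQS ξ).1 v hns T a ha h μZ π2 πn hK hn).πs := by
  -- choose the rung-0 V6 data (Borel Haar measures on the `U(Φ₃)(L⁺_v)⧸Z`; Keys' labelled pairs, hypothesis-free at `hμω`) and route `P` by `ξ` (§1)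
  have hξ : ξ = ξ' := by
    letI : ∀ v : HeightOneSpectrum (𝓞 ↥(maximalRealSubfield L)), MeasurableSpace (Gqs L v ⧸ Subgroup.center (Gqs L v)) := fun v => borel _
    haveI : ∀ v : HeightOneSpectrum (𝓞 ↥(maximalRealSubfield L)), BorelSpace (Gqs L v ⧸ Subgroup.center (Gqs L v)) := fun v => ⟨rfl⟩
    have hμZ := fun v : HeightOneSpectrum (𝓞 ↥(maximalRealSubfield L)) => F0P3Rung0HaarPackage.exists_isHaarMeasure_gqs_quotient_center L v
    haveI : ∀ v : HeightOneSpectrum (𝓞 ↥(maximalRealSubfield L)), ((hμZ v).choose).IsHaarMeasure := fun v => (hμZ v).choose_spec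
    have hK : KeysCaseTwo L := F0P3KeysCaseTwoOfStubs.keysCaseTwo_of_stubs L (F0P2oLocalLettersHold.keysCaseTwoReducible_holds L)
      (F0P3U3SquareIntegrableExponentsHolds.u3SquareIntegrableExponents_holds L)
    have hkeys := F0P3XiPacketFamilyOfRecord.exists_keysData_of_keysCaseTwo L μω hK (fun v => (hμZ v).choose)
      (fun v _ => isQuadraticCharExtension_semilocalComponent_of_baseChange_eq μω hμω v)
    obtain ⟨S, hroute⟩ := routesAt_of_ae L H hH hHd hanis μω hμu (fun v => (hμZ v).choose)
      (fun ξ v hns => Classical.choice (hkeys ξ v hns)) ξ μA P hAE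
    exact R90.S5.xi_eq_of_routesAt_of_memXiFamily_of_not_mem L H hH hHd μω hμu (fun v => (hμZ v).choose)
      (fun ξ v hns => Classical.choice (hkeys ξ v hns)) μA P ξ ξ' S hroute ⟨F, hF, hFP⟩
      (fun v _ => R90.S5.admUnitConstituents_nonempty_of_anisotropic L H μA hanis P v)
  subst hξ
  intro v hns T a ha h _ _ μZ _ π2 πn hK hn c hc
  -- the family's packet at the non-split `v` is `⟨x ∘ e′, s⟩` with `x ∈ JH(i_G(χ_ξ))`
  obtain ⟨T', a', ha', h', x, s, hFv, hx, -⟩ := hF.2 v hns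
  have hcm : c ∈ (F v).members := hFP v c hc
  rw [hFv, LocalAPacket.mem_members_iff] at hcm
  rcases hcm with hcx | hcs
  · -- `c = x ∘ e′`, `x ∈ {πⁿ, π²}` (Keys labels), and `x ∘ e′ = x ∘ e` (congruence independence)
    rcases (hK.2 x).1 hx with hxn | hx2
    · exact Or.inl (by rw [hcx, hxn, comap_cmDatumLocalCongr_symm_eq L H hH T' T ha' ha h' h])
    · exact Or.inr (Or.inl (by rw [hcx, hx2, comap_cmDatumLocalCongr_symm_eq L H hH T' T ha' ha h' h]))
  · -- the second member: the SIGNED witness (the family's pin `hFs`)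
    exact Or.inr (Or.inr (hFs v hns T a ha h μZ π2 πn hK hn c (by rw [hFv]; exact hcs)))

end Summit.HodgeConjecture.HodgeConjecture.R90.S9

end
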